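import Summits.RiemannHypothesis.RiemannHypothesis.Theses.EarlyAppointments
import Summits.RiemannHypothesis.RiemannHypothesis.Theorems.Splittings.EarlyAppointmentsXiZetaDictionary

/-!
# EarlyAppointments — `XiLevel0Inputs4`: the Ξ-side column / half-slab budgets, PROVED at booked literals (slot 11c; W-07 C6)
RH-FREE.  Nothing here bears on the truth of RH; RH is not proved.

The five defs `ColumnBudgetMult`, `HalfSlabBudget`, `XiColumnBudget`, `XiHalfSlabBudget`, `XiLevel0Inputs4` are token-identical
copies of the tenure packet (rev 5, `Rev2.*`).  Results: `xiBudgets_hold` (any `R γ ≤ 135`, `T₁ ≥ 3.0610046·10¹⁰ + 137`,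
`B γ ≥ 2W₁(2γ) + 1/100`), the CLOSED instance `xiBudgets_booked : XiColumnBudget Bstar Rstar Tstar ∧ XiHalfSlabBudget Bstar Rstar Tstar`
(`Bstar γ = ⌈2W₁(2γ) + 1/100⌉₊`, `Rstar ≡ 54`, `Tstar = 5.17·10¹¹`), and `xiLevel0Inputs4_booked (hcls : XiInLogCombClass)`.
-/

set_option linter.dupNamespace false  -- D-0017: the mandated namespace `Summit.<S>.<S>.…` repeats `RiemannHypothesis`
namespace Summit.RiemannHypothesis.RiemannHypothesis.Theorems.Splittings.EarlyAppointmentsXiLevel0Inputs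

open Real Literature.NumberTheory.LFunctions
open Summit.RiemannHypothesis.RiemannHypothesis.Theses
open Summit.RiemannHypothesis.RiemannHypothesis.Theorems.Splittings.EarlyAppointmentsXiWindowCounts
open Summit.RiemannHypothesis.RiemannHypothesis.Theorems.Splittings.EarlyAppointmentsXiZetaDictionary

/-- verbatim copies of PACKET rev 5 l.315 / l.321 / l.541 / l.545 / l.553 (the budget items and `XiLevel0Inputs4`). -/
def ColumnBudgetMult (B : ℕ) (f : ℂ → ℂ) (x₀ s R : ℝ) : Prop :=
  ∀ r : ℝ, s ≤ r → r ≤ R →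
    (∑ᶠ u ∈ {u : ℂ | f u = 0 ∧ |u.re - x₀| ≤ r}, ((analyticOrderAt f u).toNat : ℝ)) - 2 * r / s ≤ B

/-- PACKET rev 5 l.321 (verbatim): both half-slab multiplicity counts of zeros of `f` at the column `x₀`, radii `s ≤ r ≤ R`, are within `1 + B` of `r/s`. -/
def HalfSlabBudget (B : ℕ) (f : ℂ → ℂ) (x₀ s R : ℝ) : Prop :=
  ∀ r : ℝ, s ≤ r → r ≤ R →
    |(∑ᶠ u ∈ {u : ℂ | f u = 0 ∧ x₀ < u.re ∧ u.re ≤ x₀ + r}, ((analyticOrderAt f u).toNat : ℝ)) - r / s| ≤ 1 + B ∧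
    |(∑ᶠ u ∈ {u : ℂ | f u = 0 ∧ x₀ - r ≤ u.re ∧ u.re < x₀}, ((analyticOrderAt f u).toNat : ℝ)) - r / s| ≤ 1 + B

/-- PACKET rev 5 l.541 (verbatim): the column budget for `riemannXiUpper` at every centre `γ > T₁`, spacing `xiSpacing γ`, radius `R γ`, allowance `B γ`. -/
def XiColumnBudget (B : ℝ → ℕ) (R : ℝ → ℝ) (T₁ : ℝ) : Prop :=
  ∀ γ : ℝ, T₁ < γ → ColumnBudgetMult (B γ) riemannXiUpper γ (xiSpacing γ) (R γ)

/-- PACKET rev 5 l.545 (verbatim): the half-slab budget for `riemannXiUpper` at every centre `γ > T₁`, spacing `xiSpacing γ`, radius `R γ`, allowance `B γ`. -/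
def XiHalfSlabBudget (B : ℝ → ℕ) (R : ℝ → ℝ) (T₁ : ℝ) : Prop :=
  ∀ γ : ℝ, T₁ < γ → HalfSlabBudget (B γ) riemannXiUpper γ (xiSpacing γ) (R γ)

/-- PACKET rev 5 l.553 (verbatim): the class input `XiInLogCombClass` together with the column and half-slab budgets. -/
def XiLevel0Inputs4 (B : ℝ → ℕ) (R : ℝ → ℝ) (T₁ : ℝ) : Prop :=
  EarlyAppointments.XiInLogCombClass ∧ XiColumnBudget B R T₁ ∧ XiHalfSlabBudget B R T₁

/-- **ASSEMBLY — `XiLevel0Inputs4` modulo the class input and the DICTIONARY**, for any booking with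
`T₁ ≥ 3.0610046·10¹⁰ + 137`, `0 < s(γ)`, `s(γ) ≤ r ≤ R γ ≤ 135` (booked: 54/54/68), `2·W₁(2γ) + 1/100 ≤ B γ` above `T₁`. -/
theorem xiBudgets_of {B : ℝ → ℕ} {R : ℝ → ℝ} {T₁ : ℝ}
    (hDc : XiDictColumn) (hDr : XiDictRight) (hDl : XiDictLeft)
    (hT₁ : 30610046000 + 137 ≤ T₁) (hR : ∀ γ, T₁ < γ → R γ ≤ 135) (hs : ∀ γ, T₁ < γ → 0 < xiSpacing γ)
    (hB : ∀ γ, T₁ < γ → 2 * W₁ (2 * γ) + 1 / 100 ≤ (B γ : ℝ)) :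
    XiColumnBudget B R T₁ ∧ XiHalfSlabBudget B R T₁ := by
  refine ⟨?_, ?_⟩
  · -- COLUMN
    intro γ hγ r hsr hrR
    have hr0 : 0 < r := lt_of_lt_of_le (hs γ hγ) hsr
    have hr67 : r ≤ 135 := hrR.trans (hR γ hγ)
    have hsγ := hs γ hγ
    have hBγ := hB γ hγ
    -- for every ε ∈ (0,1]: Σ − 2r/s ≤ 2W₁(2γ) + 1/100 + 2ε/s
    have key : ∀ ε : ℝ, 0 < ε → ε ≤ 1 →
        (∑ᶠ u ∈ {u : ℂ | riemannXiUpper u = 0 ∧ |u.re - γ| ≤ r}, xiOrd u) - 2 * r / xiSpacing γ ≤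
          2 * W₁ (2 * γ) + 1 / 100 + 2 * ε / xiSpacing γ := by
      intro ε hε hε1
      have d := hDc γ r ε hr0.le hε (by linarith)
      have w := window_count_abs_le_TB (γ := γ) (a := γ - r - ε) (b := γ + r + ε) (by linarith) (by linarith)
        (by linarith) (by linarith)
      have w' := (abs_le.1 w).2
      have e : (γ + r + ε - (γ - r - ε)) / xiSpacing γ = 2 * r / xiSpacing γ + 2 * ε / xiSpacing γ := by
        rw [show γ + r + ε - (γ - r - ε) = 2 * r + 2 * ε by ring, add_div]
      linarith
    have main : (∑ᶠ u ∈ {u : ℂ | riemannXiUpper u = 0 ∧ |u.re - γ| ≤ r}, xiOrd u) - 2 * r / xiSpacing γ ≤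
        2 * W₁ (2 * γ) + 1 / 100 := by
      refine le_of_forall_pos_le_add fun δ hδ => ?_
      set ε := min 1 (δ * xiSpacing γ / 2) with hεdef
      have hε : 0 < ε := lt_min one_pos (by nlinarith [mul_pos hδ hsγ])
      have hε1 : ε ≤ 1 := min_le_left _ _
      have hε2 : ε ≤ δ * xiSpacing γ / 2 := min_le_right _ _
      have h2 : 2 * ε / xiSpacing γ ≤ δ := by
        rw [div_le_iff₀ hsγ]; linarith
      linarith [key ε hε hε1]
    show (∑ᶠ u ∈ {u : ℂ | riemannXiUpper u = 0 ∧ |u.re - γ| ≤ r},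
        ((analyticOrderAt riemannXiUpper u).toNat : ℝ)) - 2 * r / xiSpacing γ ≤ (B γ : ℝ)
    exact main.trans hBγ
  · -- HALF-SLABS
    intro γ hγ r hsr hrR
    have hr0 : 0 < r := lt_of_lt_of_le (hs γ hγ) hsr
    have hr67 : r ≤ 135 := hrR.trans (hR γ hγ)
    have hsγ := hs γ hγ
    have hBγ := hB γ hγ
    constructor
    · -- right (γ, γ+r]: exact dictionary
      have d := hDr γ r (by linarith) hr0.le
      have w := window_count_abs_le_TB (γ := γ) (a := γ) (b := γ + r) (by linarith) (by linarith) (by linarith)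
        (by linarith)
      rw [show γ + r - γ = r by ring] at w
      show |(∑ᶠ u ∈ {u : ℂ | riemannXiUpper u = 0 ∧ γ < u.re ∧ u.re ≤ γ + r},
          ((analyticOrderAt riemannXiUpper u).toNat : ℝ)) - r / xiSpacing γ| ≤ 1 + (B γ : ℝ)
      have e : (∑ᶠ u ∈ {u : ℂ | riemannXiUpper u = 0 ∧ γ < u.re ∧ u.re ≤ γ + r},
          ((analyticOrderAt riemannXiUpper u).toNat : ℝ)) = (zetaZeroCount (γ + r) : ℝ) - zetaZeroCount γ := d
      rw [e]
      linarith
    · -- left [γ−r, γ): sandwich with ε → 0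
      have key : ∀ ε : ℝ, 0 < ε → ε ≤ 1 → ε ≤ r →
          |(∑ᶠ u ∈ {u : ℂ | riemannXiUpper u = 0 ∧ γ - r ≤ u.re ∧ u.re < γ}, xiOrd u) - r / xiSpacing γ| ≤
            2 * W₁ (2 * γ) + 1 / 100 + ε / xiSpacing γ := by
        intro ε hε hε1 hεr
        obtain ⟨dlo, dhi⟩ := hDl γ r ε hε hεr (by linarith)
        have wu := window_count_abs_le_TB (γ := γ) (a := γ - r - ε) (b := γ) (by linarith) (by linarith)
          (by linarith) (by linarith)
        have wl := window_count_abs_le_TB (γ := γ) (a := γ - r) (b := γ - ε) (by linarith) (by linarith)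
          (by linarith) (by linarith)
        rw [show γ - (γ - r - ε) = r + ε by ring, add_div] at wu
        rw [show γ - ε - (γ - r) = r - ε by ring, sub_div] at wl
        have wu' := (abs_le.1 wu).2
        have wl' := (abs_le.1 wl).1
        rw [abs_le]; constructor <;> linarith
      have main : |(∑ᶠ u ∈ {u : ℂ | riemannXiUpper u = 0 ∧ γ - r ≤ u.re ∧ u.re < γ}, xiOrd u) - r / xiSpacing γ| ≤
          2 * W₁ (2 * γ) + 1 / 100 := by
        refine le_of_forall_pos_le_add fun δ hδ => ?_
        set ε := min (min 1 r) (δ * xiSpacing γ) with hεdef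
        have hε : 0 < ε := lt_min (lt_min one_pos hr0) (mul_pos hδ hsγ)
        have hε1 : ε ≤ 1 := (min_le_left _ _).trans (min_le_left _ _)
        have hεr : ε ≤ r := (min_le_left _ _).trans (min_le_right _ _)
        have hε2 : ε ≤ δ * xiSpacing γ := min_le_right _ _
        have h2 : ε / xiSpacing γ ≤ δ := by rw [div_le_iff₀ hsγ]; linarith
        linarith [key ε hε hε1 hεr]
      show |(∑ᶠ u ∈ {u : ℂ | riemannXiUpper u = 0 ∧ γ - r ≤ u.re ∧ u.re < γ},
          ((analyticOrderAt riemannXiUpper u).toNat : ℝ)) - r / xiSpacing γ| ≤ 1 + (B γ : ℝ)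
      have e : |(∑ᶠ u ∈ {u : ℂ | riemannXiUpper u = 0 ∧ γ - r ≤ u.re ∧ u.re < γ}, xiOrd u) - r / xiSpacing γ| =
          |(∑ᶠ u ∈ {u : ℂ | riemannXiUpper u = 0 ∧ γ - r ≤ u.re ∧ u.re < γ},
            ((analyticOrderAt riemannXiUpper u).toNat : ℝ)) - r / xiSpacing γ| := rfl
      linarith [main, e]

/-- **ASSEMBLY — `XiLevel0Inputs4` modulo the class input and the DICTIONARY (three window shapes).** -/
theorem xiLevel0Inputs4_of {B : ℝ → ℕ} {R : ℝ → ℝ} {T₁ : ℝ}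
    (hcls : EarlyAppointments.XiInLogCombClass) (hDc : XiDictColumn) (hDr : XiDictRight) (hDl : XiDictLeft)
    (hT₁ : 30610046000 + 137 ≤ T₁) (hR : ∀ γ, T₁ < γ → R γ ≤ 135) (hs : ∀ γ, T₁ < γ → 0 < xiSpacing γ)
    (hB : ∀ γ, T₁ < γ → 2 * W₁ (2 * γ) + 1 / 100 ≤ (B γ : ℝ)) :
    XiLevel0Inputs4 B R T₁ :=
  ⟨hcls, xiBudgets_of hDc hDr hDl hT₁ hR hs hB⟩

/-- **ASSEMBLY from the half-open dictionary**: `XiLevel0Inputs4` ⟸ class ∧ `stub_L1c`(ℝ) ∧ window finiteness, booked side conditions. -/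
theorem xiLevel0Inputs4_of_halfOpen {B : ℝ → ℕ} {R : ℝ → ℝ} {T₁ : ℝ}
    (hcls : EarlyAppointments.XiInLogCombClass) (hD : XiDictHalfOpen) (hF : XiZerosWindowFinite)
    (hT₁ : 30610046000 + 137 ≤ T₁) (hR : ∀ γ, T₁ < γ → R γ ≤ 135) (hs : ∀ γ, T₁ < γ → 0 < xiSpacing γ)
    (hB : ∀ γ, T₁ < γ → 2 * W₁ (2 * γ) + 1 / 100 ≤ (B γ : ℝ)) :
    XiLevel0Inputs4 B R T₁ := by
  obtain ⟨hDc, hDr, hDl⟩ := xiDict_of_halfOpen hD hF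
  exact xiLevel0Inputs4_of hcls hDc hDr hDl hT₁ hR hs hB

/-- **ASSEMBLY, final form of this seat**: `XiLevel0Inputs4` ⟸ `XiInLogCombClass` ∧ the half-open dictionary `XiDictHalfOpen`
(= C3 `stub_L1c` over ℝ), under the booked side conditions — window finiteness now discharged. -/
theorem xiLevel0Inputs4_of_dictionary {B : ℝ → ℕ} {R : ℝ → ℝ} {T₁ : ℝ}
    (hcls : EarlyAppointments.XiInLogCombClass) (hD : XiDictHalfOpen)
    (hT₁ : 30610046000 + 137 ≤ T₁) (hR : ∀ γ, T₁ < γ → R γ ≤ 135) (hs : ∀ γ, T₁ < γ → 0 < xiSpacing γ)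
    (hB : ∀ γ, T₁ < γ → 2 * W₁ (2 * γ) + 1 / 100 ≤ (B γ : ℝ)) :
    XiLevel0Inputs4 B R T₁ :=
  xiLevel0Inputs4_of_halfOpen hcls hD xiZerosWindowFinite_holds hT₁ hR hs hB

section Booked

open Complex

/-- ★ **`XiLevel0Inputs4` ⟸ `XiInLogCombClass` ALONE (plus the booked side conditions)**: both budget conjuncts are PROVED. -/
theorem xiLevel0Inputs4_of_class {B : ℝ → ℕ} {R : ℝ → ℝ} {T₁ : ℝ}
    (hcls : EarlyAppointments.XiInLogCombClass)
    (hT₁ : 30610046000 + 137 ≤ T₁) (hR : ∀ γ, T₁ < γ → R γ ≤ 135) (hs : ∀ γ, T₁ < γ → 0 < xiSpacing γ)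
    (hB : ∀ γ, T₁ < γ → 2 * W₁ (2 * γ) + 1 / 100 ≤ (B γ : ℝ)) :
    XiLevel0Inputs4 B R T₁ :=
  xiLevel0Inputs4_of_dictionary hcls xiDictHalfOpen_holds hT₁ hR hs hB

/-- **THE BUDGET CONJUNCTS OF `XiLevel0Inputs4`, UNCONDITIONALLY** (RH-free theorems about Ξ, booked side conditions). -/
theorem xiBudgets_hold {B : ℝ → ℕ} {R : ℝ → ℝ} {T₁ : ℝ}
    (hT₁ : 30610046000 + 137 ≤ T₁) (hR : ∀ γ, T₁ < γ → R γ ≤ 135) (hs : ∀ γ, T₁ < γ → 0 < xiSpacing γ)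
    (hB : ∀ γ, T₁ < γ → 2 * W₁ (2 * γ) + 1 / 100 ≤ (B γ : ℝ)) :
    XiColumnBudget B R T₁ ∧ XiHalfSlabBudget B R T₁ := by
  obtain ⟨hDc, hDr, hDl⟩ := xiDict_of_halfOpen xiDictHalfOpen_holds xiZerosWindowFinite_holds
  exact xiBudgets_of hDc hDr hDl hT₁ hR hs hB

/-- THE BOOKED INSTANCE (words of PACKET rev 5 l.42/525/881 made literal): `B⋆ γ = ⌈2·W₁(2γ) + 1/100⌉₊`, `R⋆ ≡ 54`, `T₁⋆ = 5.17·10¹¹`. -/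
noncomputable def Bstar (γ : ℝ) : ℕ := ⌈2 * W₁ (2 * γ) + 1 / 100⌉₊

/-- Booked radius (the A-class value; any `R ≤ 135` works). -/
def Rstar (_γ : ℝ) : ℝ := 54

/-- Booked switch-on height. -/
def Tstar : ℝ := 5.17e11

/-- The local mean spacing is positive above the booked height: `0 < xiSpacing γ` for `Tstar < γ`. -/
theorem xiSpacing_pos_of {γ : ℝ} (hγ : Tstar < γ) : 0 < xiSpacing γ := by
  have h2 : (0 : ℝ) < 2 * Real.pi := by positivity
  have hπ : 2 * Real.pi < Tstar := by
    have := Real.pi_lt_four; norm_num [Tstar]; linarith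
  exact div_pos h2 (Real.log_pos ((one_lt_div h2).2 (hπ.trans hγ)))

/-- ★ **THE BUDGET CONJUNCTS AT THE BOOKED LITERALS — a closed theorem, no hypotheses.** -/
theorem xiBudgets_booked : XiColumnBudget Bstar Rstar Tstar ∧ XiHalfSlabBudget Bstar Rstar Tstar :=
  xiBudgets_hold (by norm_num [Tstar]) (fun γ _ => by norm_num [Rstar]) (fun γ hγ => xiSpacing_pos_of hγ)
    (fun γ _ => Nat.le_ceil _)

/-- ★ **(CA151) TARGET modulo the one named lemma**: `XiLevel0Inputs4 B⋆ R⋆ T₁⋆` ⟸ `XiInLogCombClass`. -/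
theorem xiLevel0Inputs4_booked (hcls : EarlyAppointments.XiInLogCombClass) : XiLevel0Inputs4 Bstar Rstar Tstar :=
  ⟨hcls, xiBudgets_booked⟩

end Booked

end Summit.RiemannHypothesis.RiemannHypothesis.Theorems.Splittings.EarlyAppointmentsXiLevel0Inputs
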